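import Literature.MathematicalPhysics.QuantumFieldTheory.Balaban1983to89.B16Thm1BaseAtRecord11

/-!
# DAG node N11 — [B14] Thm 1 ([Balaban1988Convergent] CMP **119** (1988) 243–285, Thm 1 p. 262) AT NODE 00's STAGE-11 RECORD `Node00.IsRecordOfRecord₁₁C`:
# THE NODE'S OWN LEAF `densitiesDescribed` IS UNSATISFIABLE AT EVERY RUN WITH NON-ZERO BARE COUPLING, THEOREM 1 AS PINNED (`B16.Thm1Printed`) FAILS AT
# EVERY STAGE-11 DATUM WITH NO WINDOW HYPOTHESIS, AND `Dag.B14_main` HOLDS AT A STAGE-11 RECORD EXACTLY WHEN ITS ANTECEDENTS ARE JOINTLY UNSATISFIABLE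

Cell `pub-ymgap`, YM-PLAN Track A (HUMAN RULING D-0062), seat `pub-ymgap-dag-n11-d` (R134 fan-out, node N11, strategy s2 «Thm 1 with 𝐑 explicit at `Record11`
now that `Sect2Form` is PINNED»), director-ym LINE №81 (2)(b) («n11-d: 3-thm corollary after (I)»), dag-lead ★FLAG-ROUTING ∕ DEDUP-150.  (I) = seat
dag-n13-e's `…Balaban1983to89.B16Thm1BaseAtRecord11` (p455067): the LOCATED NEGATIVE at the induction base — the level-0 background map of record reads no
configuration (`UbgOfRecord_zero_const`), so the pinned §2 format law `Node00.SLaw₁₁ θ p 0` forces `ρ₀` to be a.e. constant and FAILS for `N ≥ 2` at every run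
with non-zero bare coupling (`not_sLaw₁₁_zero`, `not_sect2Form_zero_datumOfRecord₁₁`) — kernel-confirmed independently by this seat (scratch
`HOME/pub-ymgap-dag-n11-d/lean/ProbeSect2FormZero.lean`, not filed: ONE public name per object) and by dag-n11-e.  THIS FILE re-keys the N11 side on (I) BY NAME
and types NOTHING of the level-0 mechanism again.

WHAT THIS FILE PROVES (theorems only; every ingredient by name from (I), `Node00/Record11`, `DagBinding`, `Dag`).
§1 THE WINDOW HYPOTHESIS OF (I) §4 IS VOID: the run `(K, m, g₀) = (0, m, γ)` of ANY construction of record lies in the `γ`-window (its only coupling is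
   `g₀ = γ`, `FlowStepRuns.genSeq_zero`), so `B16.Thm1Printed (datumOfRecord₁₁ F N θ h).C` — [V] Thm 1 ∕ [III] Thm 1 AS PINNED — is FALSE at EVERY Stage-11
   datum (`not_thm1Printed_datumOfRecord₁₁`), hence so is the pin (B) `B16.EndStatementBPrinted` (`not_endStatementBPrinted_datumOfRecord₁₁`), at every
   Stage-11 record (`not_endStatementBPrinted_of_isRecordOfRecord₁₁C`) — (I)'s `…_of_window` theorems with the window discharged.
§2 N11'S OWN LEAF: at a Stage-11 record's world `w` (`w.C = D.C`, `D = datumOfRecord₁₁ θ h`) the node's conclusion `(leavesP w P).densitiesDescribed`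
   (= `∀ k ≤ K, (w.C P).Sect2Form k`, whose `k = 0` clause IS `SLaw₁₁ θ P 0`, `sect2Form_stage11_iff`) FAILS at every run with `P.g0 ≠ 0`
   (`not_densitiesDescribed_of_isRecordOfRecord₁₁C`), in particular under the node's own interval hypothesis `smallCouplings` (`0 < g₀`;
   `not_densitiesDescribed_of_smallCouplings`); hence **`b14_main_iff_antecedents_false`**: `Dag.B14_main (leavesP w P)` ([Balaban1988Convergent] Thm 1 p. 262
   with the Theorem of p. 245 and the assumed 𝐑 of p. 244, the node's statement of record) HOLDS at a Stage-11 record EXACTLY WHEN its antecedents — the in-edges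
   `b7 … b11`, the small-field assumptions, the flow control (2.6), the 𝐑-leaf and the interval hypothesis — are JOINTLY UNSATISFIABLE.  Every Stage-11 knit of
   N11 (`…B14NodeKnitRecord11R`, `…BalabanUVNodesN11AtRecord11C`, the N11 face of `Node00/N24KnitStage11C`) reads its (S0) slot `smallCouplings → SLaw₁₁ θ P 0`,
   which §2 shows unsatisfiable: those knits are correct implications with no content at Stage 11 and become live by re-instantiation at the repaired record
   (director-ym LINE №81 (3); repair = the level-0 background pin of `Node00/Record12`, node00-def-T).

HONEST FRAMING.  A LOCATED NEGATIVE about the tree's Stage-11 PIN (class misstated-pin), count-neutral: nothing of Bałaban's is refuted or asserted — print's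
base «ρ₀ = exp[−(1∕g₀²)A − E]» has the (2.18) form trivially with `U₀ = U` ((I) §6 `hasSect2FormAE_zero_printedBackground`); N11 is NOT discharged and NOT
refuted; counts unmoved (typed 28∕28 · discharged 5∕28).  One finite four-torus programme at fixed ε; NOT ℝ⁴, NOT OS, NOT a mass gap, NOT Clay.
Sources: [Balaban1988Convergent] Thm 1 p. 262, Theorem p. 245, p. 244; [Balaban1989LargeFieldII] Thm 1 p. 355.
-/

noncomputable section

namespace Summit.QuantumFields.YangMills.Theorems.BalabanUVNodesN11AtRecord11Vacuity

open Literature.MathematicalPhysics.QuantumFieldTheory.Balaban1983to89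
open Node00 T4Continuum DagBinding
open B16Thm1BaseAtRecord11 (not_sect2Form_zero_datumOfRecord₁₁)

variable {F : T4Family} {N : ℕ} [NeZero N]

/-! ## §1. Theorem 1 as pinned fails at EVERY Stage-11 datum (the window hypothesis of (I) §4 discharged) -/

/-- The bare run `(0, m, γ)` of the Stage-11 datum of record has first (and only) coupling `g₀ = γ` (`flow_g_datumOfRecord₁₁`, `FlowStepRuns.genSeq_zero`).
[cite: Balaban1987RG1, (0.17)–(0.20) pp.255–256 (bookkeeping)] -/
theorem flow_g_zero_datumOfRecord₁₁ (θ : Stage11Params F N) (h : θ.Provisos₁₁) (P : B12.RunParams) :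
    ((datumOfRecord₁₁ F N θ h).C P).flow.g 0 = P.g0 := by
  rw [flow_g_datumOfRecord₁₁]
  exact FlowStepRuns.genSeq_zero _ _

/-- … so for every `γ > 0` the run `(0, m, γ)` lies in the `γ`-window `]0, γ]` up to its `K = 0`. [cite: Balaban1987RG1, (0.21) p.256 (bookkeeping)] -/
theorem inInterval_run_zero_datumOfRecord₁₁ (θ : Stage11Params F N) (h : θ.Provisos₁₁) (m : ℕ) {γ : ℝ} (hγ : 0 < γ) :
    ((datumOfRecord₁₁ F N θ h).C ⟨0, m, γ⟩).flow.InInterval γ 0 := by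
  intro k hk
  obtain rfl : k = 0 := Nat.le_zero.1 hk
  rw [flow_g_zero_datumOfRecord₁₁]
  exact ⟨hγ, le_rfl⟩

/-- **[V] THEOREM 1 ∕ [III] THEOREM 1 AS PINNED AT STAGE 11 (`B16.Thm1Printed`) IS FALSE AT EVERY STAGE-11 DATUM OF RECORD**, `N ≥ 2`, with NO window hypothesis:
whatever `γ > 0` the conclusion is read with, the run `(0, m, γ)` lies in the window and its step-0 clause `Sect2Form 0` fails ((I):
`not_sect2Form_zero_datumOfRecord₁₁`).  Strengthens (I)'s `not_thm1Printed_datumOfRecord₁₁_of_window`. [cite: Balaban1989LargeFieldII, Thm 1 p.355; Balaban1988Convergent, Thm 1 p.262 (as pinned at the tree's Stage-11 record; located negative)] -/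
theorem not_thm1Printed_datumOfRecord₁₁ (hN : 2 ≤ N) (θ : Stage11Params F N) (h : θ.Provisos₁₁) :
    ¬ B16.Thm1Printed (datumOfRecord₁₁ F N θ h).C := by
  rintro ⟨γ, hγ, hall⟩
  have hg : ((datumOfRecord₁₁ F N θ h).C ⟨0, F.m, γ⟩).flow.g 0 ≠ 0 := by
    rw [flow_g_zero_datumOfRecord₁₁]
    exact hγ.ne'
  exact not_sect2Form_zero_datumOfRecord₁₁ F N θ h hN ⟨0, F.m, γ⟩ hg
    (hall ⟨0, F.m, γ⟩ (inInterval_run_zero_datumOfRecord₁₁ θ h F.m hγ) 0 le_rfl)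

/-- **THE PIN (B) `B16.EndStatementBPrinted` (= Thm 1 ∧ [III] Cor. 3) IS FALSE AT EVERY STAGE-11 DATUM OF RECORD**, `N ≥ 2`, unconditionally.
[cite: Balaban1989LargeFieldII, Thm 1 p.355 + p.391 (as pinned; located negative)] -/
theorem not_endStatementBPrinted_datumOfRecord₁₁ (hN : 2 ≤ N) (θ : Stage11Params F N) (h : θ.Provisos₁₁) :
    ¬ B16.EndStatementBPrinted (datumOfRecord₁₁ F N θ h).C :=
  fun hB => not_thm1Printed_datumOfRecord₁₁ hN θ h hB.1

variable {D : FiniteEpsData F (SU N)} {w : WorldP}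

/-- **AT EVERY STAGE-11 RECORD `(D, w)` THE PIN (B) FAILS**, `N ≥ 2` — no window hypothesis (strengthens (I)'s
`not_endStatementBPrinted_of_isRecordOfRecord₁₁C_of_window`): the hypothesis «record ∧ (B)» of the route's Stage-11 items K2∕K3 is unsatisfiable at EVERY record,
and the consequent «record ∧ (B) ∧ window» of K1 at every family. [cite: Balaban1989LargeFieldII, Thm 1 p.355 + p.391 (as pinned at the tree's Stage-11 record; located negative)] -/
theorem not_endStatementBPrinted_of_isRecordOfRecord₁₁C (hN : 2 ≤ N) (hR : IsRecordOfRecord₁₁C F N D w) : ¬ B16.EndStatementBPrinted D.C := by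
  obtain ⟨θ, h, -, rfl, -⟩ := hR
  exact not_endStatementBPrinted_datumOfRecord₁₁ hN θ h

/-! ## §2. N11's own leaf at a Stage-11 record, and the node statement `Dag.B14_main` there -/

/-- **N11's CONCLUSION `densitiesDescribed` FAILS AT EVERY RUN WITH NON-ZERO BARE COUPLING** of a Stage-11 record's world (`N ≥ 2`): its `k = 0` clause is the
pinned `Sect2Form 0` of the datum of record at `P`, i.e. `SLaw₁₁ θ P 0` ((I) `not_sect2Form_zero_datumOfRecord₁₁`; `w.C = D.C`). [cite: Balaban1988Convergent, Thm 1 p.262 (as pinned at the tree's Stage-11 record; located negative)] -/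
theorem not_densitiesDescribed_of_isRecordOfRecord₁₁C (hN : 2 ≤ N) (hR : IsRecordOfRecord₁₁C F N D w) (P : B12.RunParams) (hP : P.g0 ≠ 0) :
    ¬ (leavesP w P).densitiesDescribed := by
  obtain ⟨θ, h, -, rfl, hC, -⟩ := hR
  intro hd
  have h0 : (w.C P).Sect2Form 0 := hd 0 (Nat.zero_le _)
  rw [hC] at h0
  refine not_sect2Form_zero_datumOfRecord₁₁ F N θ h hN P ?_ h0
  rw [flow_g_zero_datumOfRecord₁₁]
  exact hP

/-- … in particular under the node's own interval hypothesis `smallCouplings` (`(w.C P).flow.InInterval w.γ P.K`, which gives `0 < g₀ = P.g0`).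
[cite: Balaban1988Convergent, Thm 1 p.262 (as pinned; located negative)] -/
theorem not_densitiesDescribed_of_smallCouplings (hN : 2 ≤ N) (hR : IsRecordOfRecord₁₁C F N D w) (P : B12.RunParams)
    (hsc : (leavesP w P).smallCouplings) : ¬ (leavesP w P).densitiesDescribed := by
  refine not_densitiesDescribed_of_isRecordOfRecord₁₁C hN hR P ?_
  obtain ⟨θ, h, -, rfl, hC, -⟩ := hR
  have h0 := (hsc 0 (Nat.zero_le _)).1
  rw [hC, flow_g_zero_datumOfRecord₁₁] at h0
  exact h0.ne'

/-- **N11 AT A STAGE-11 RECORD HOLDS EXACTLY WHEN ITS ANTECEDENTS ARE JOINTLY UNSATISFIABLE** (`N ≥ 2`): the node statement of record `Dag.B14_main (leavesP w P)`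
([Balaban1988Convergent] Thm 1 p. 262 with the Theorem of p. 245 and the assumed 𝐑 of p. 244: `b7 → b8 → b9 → b10 → b11 → (smallCouplings → smallFieldInductive) →
(smallCouplings → flowControl) → rOperation → smallCouplings → densitiesDescribed`) is EQUIVALENT, at every run of every Stage-11 record's world, to the statement
that the in-edges, the small-field assumptions, the flow control, the 𝐑-leaf and the interval hypothesis cannot all hold — its conclusion being false under
`smallCouplings` (`not_densitiesDescribed_of_smallCouplings`).  So every Stage-11 knit of N11 is satisfiable only vacuously; the node is neither discharged
nor refuted (the pin, not the paper, is at fault: (I) §6). [cite: Balaban1988Convergent, Thm 1 p.262, Theorem p.245, p.244 (node statement as pinned at the tree's Stage-11 record; located)] -/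
theorem b14_main_iff_antecedents_false (hN : 2 ≤ N) (hR : IsRecordOfRecord₁₁C F N D w) (P : B12.RunParams) :
    Dag.B14_main (leavesP w P) ↔
      ((leavesP w P).b7 → (leavesP w P).b8 → (leavesP w P).b9 → (leavesP w P).b10 → (leavesP w P).b11 →
        ((leavesP w P).smallCouplings → (leavesP w P).smallFieldInductive) → ((leavesP w P).smallCouplings → (leavesP w P).flowControl) →
        (leavesP w P).rOperation → ¬ (leavesP w P).smallCouplings) := by
  refine ⟨fun hm h7 h8 h9 h10 h11 hsf hfc hrop hsc => ?_, fun hna h7 h8 h9 h10 h11 hsf hfc hrop hsc => ?_⟩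
  · exact not_densitiesDescribed_of_smallCouplings hN hR P hsc (hm h7 h8 h9 h10 h11 hsf hfc hrop hsc)
  · exact absurd hsc (hna h7 h8 h9 h10 h11 hsf hfc hrop)

/-- Consequently, at a Stage-11 record N11 CANNOT be discharged with content: whenever its antecedents hold at a run (in-edges, small-field assumptions, flow
control, 𝐑-leaf, interval hypothesis), `Dag.B14_main (leavesP w P)` is FALSE there (`N ≥ 2`). [cite: Balaban1988Convergent, Thm 1 p.262 (as pinned; located negative)] -/
theorem not_b14_main_of_antecedents (hN : 2 ≤ N) (hR : IsRecordOfRecord₁₁C F N D w) (P : B12.RunParams)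
    (h7 : (leavesP w P).b7) (h8 : (leavesP w P).b8) (h9 : (leavesP w P).b9) (h10 : (leavesP w P).b10) (h11 : (leavesP w P).b11)
    (hsf : (leavesP w P).smallCouplings → (leavesP w P).smallFieldInductive) (hfc : (leavesP w P).smallCouplings → (leavesP w P).flowControl)
    (hrop : (leavesP w P).rOperation) (hsc : (leavesP w P).smallCouplings) : ¬ Dag.B14_main (leavesP w P) :=
  fun hm => not_densitiesDescribed_of_smallCouplings hN hR P hsc (hm h7 h8 h9 h10 h11 hsf hfc hrop hsc)

end Summit.QuantumFields.YangMills.Theorems.BalabanUVNodesN11AtRecord11Vacuity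

end
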